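import Summits.BirchSwinnertonDyer.BirchSwinnertonDyer.Theorems.UniversalToricDescentToricTransportModThreeFlatGlue
import Summits.BirchSwinnertonDyer.BirchSwinnertonDyer.Theorems.UniversalToricDescentDefectTransportTorsionMu
import HarnessLib

/-!
# Route `UniversalToricDescent` (rev 44, act E) — the cross-squeeze re-threaded on ♭T′ `DefectTransportModThreePT`
# (stmt-BirchSwinnertonDyer-26975) → wall 20395 → μ 20400, in TWO currencies: act E's (the twin hands a frame with the
# rational Wan clause) and the TORSION-CONDITIONAL one (the twin owes the clause only once `X^∅_ac(W′)` is `Λ`-torsion —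
# which the squeeze itself PROVES on the way, by utd-p1's residual transport p611201)

Cell `bsd-wall`, width seat `bsd-wall-utd-p2-w2` (prover g3, 2026-08-28); `--supports stmt-BirchSwinnertonDyer-26977 --as helper`
(kernel″'s squeeze half; the kernel half is the sibling file `UniversalToricDescentToricKernelAtThreeApZeroOddDefectPTOfPrint`).

## What this file proves (theorems only; every hypothesis displayed; no definition, no named fact, no `sorry`)

* §1 `twinTorsion_of_defectPT_of_wall` — under ♭T′'s binders at a pair of frames `(L, L′)`: ♭T′ returns a first-unit index
  `m` of the `E`-frame `L`; `UniversalToricDescentDefectTransport.defectTransport_torsionMu_of_wall` (p611201: Greenberg–Vatsal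
  finiteness-form residual transfer along `E[3] ≃ W′[3]`, no (iv), no Poitou–Tate, no base finiteness) turns `X^∅_ac(E)` torsion
  + the wall `(L) ⊆ Ch(E)·R₀⟦T⟧` + `‖coeff m L‖ = 1` into **`X^∅_ac(W′/K_∞; slot 𝔭′)` TORSION for the twin**.
* §2 `charIdeal_eq_of_defectPT_of_wall_of_mu_torsionConditional` — ♭T′ → wall → μ → (Flat′'s binders, the handed twin
  frame's Wan clause owed ONLY UNDER torsion of `X^∅_ac(W′)`) → `Ch(E)·R₀⟦T⟧ = (L)`: p609855's squeeze
  (`UniversalToricDescentActDFlatGlue.toricTransportModThreeFlat_of_wall_of_defect_of_mu`) with §1 inserted between «♭T′ at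
  `(L, L′)`» and «the clause»; `charIdeal_eq_of_defectPT_of_wall_of_mu` — act E's currency (unconditional clause) as the
  special case; `twinIMC_of_defectPT_of_wall_of_mu_torsionConditional` — bonus: the twin's own equality `Ch(W′)·R₀⟦T⟧ = (L′)`.

So on the deciding chain the twin cruxes ♭B 26062 / ♭C₀ 26063 may be WEAKENED to «∃ frame `L′` ∧ (torsion of `X^∅_ac(W′)` →
∃ k, `3^k·Ch(W′)·R₀⟦T⟧ ⊆ (L′)`)» at no cost: the research atom «`X^∅_ac(W′/K_∞)` is `Λ`-torsion» (`stub_torsionMult` of the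
lines threeframes v7 / membertower v4) is a THEOREM in the kernel's context (planner datum act F, certificate
`Cruxes/TwinSplitIMCAtThreeMult/ActF_TorsionConditionalTwin.lean`). CONDITIONAL on the displayed hypotheses (♭T′ is
conjecture-grade research, 20395 is THE WALL, 20400 is print modulo Hsieh any-level); closes nothing by itself; BSD is not
proved by any of this.

References: [GreenbergVatsal2000] Thm. (1.4), §2 Prop. (2.8); [Brink2007] Thm. 2, Cor. 1; [JetchevSkinnerWan2017] §7.4.
-/

noncomputable section

open scoped Classical

set_option linter.dupNamespace false
set_option autoImplicit false

namespace Summit.BirchSwinnertonDyer.BirchSwinnertonDyer.Theorems.UniversalToricDescentDefectPTSqueeze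

open WeierstrassCurve NumberField IsDedekindDomain Field
  Literature.NumberTheory.EllipticCurves
  Literature.NumberTheory.EllipticCurves.ModularForms
  Literature.NumberTheory.EllipticCurves.Rank1Residual
  Summit.BirchSwinnertonDyer.Rank1Residual
  Summit.BirchSwinnertonDyer.Rank1Residual.Additive
  Summit.BirchSwinnertonDyer.Rank1Residual.X11b
  Summit.BirchSwinnertonDyer.Rank1Residual.X11b.AcSelmer
  Summit.BirchSwinnertonDyer.Rank1Residual.X11b.Halves
  Summit.BirchSwinnertonDyer.BirchSwinnertonDyer.Theses.UniversalToricDescent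
  Summit.BirchSwinnertonDyer.BirchSwinnertonDyer.Theorems
  Summit.BirchSwinnertonDyer.BirchSwinnertonDyer.Theorems.UniversalToricDescentActDFlatGlue
  Summit.BirchSwinnertonDyer.BirchSwinnertonDyer.Theorems.UniversalToricDescentNormProfile
  Summit.BirchSwinnertonDyer.BirchSwinnertonDyer.Theorems.UniversalToricDescentDefectTransport

section Squeeze

variable (W : WeierstrassCurve ℚ) [W.IsElliptic] [W.IsGloballyMinimal] (W' : WeierstrassCurve ℚ) [W'.IsElliptic]
  [W'.IsGloballyMinimal] (N N' : ℕ) [NeZero N] [NeZero N'] (K : Type) [Field K] [NumberField K]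
  (Dt : ModularParametrizationData W N) (Dt' : ModularParametrizationData W' N')

/-! ### §1 The transport step: torsion of `X^∅_ac(W′)` from the kernel's data -/

/-- **Torsion of the twin's `X^∅_ac` from ♭T′ + wall + `X^∅_ac(E)` torsion, at any pair of frames `(L, L′)` with `μ(L′) = 0`.**
♭T′ (`DefectTransportModThreePT`, 26975) applied at `(L, L′)` returns a first-unit index `m` of `L`; the tree theorem
`defectTransport_torsionMu_of_wall` (p611201; Greenberg–Vatsal finiteness-form residual comparison along `E[3] ≃ W′[3]`)
transports `X^∅_ac(E)` torsion + `(L) ⊆ Ch(E)·R₀⟦T⟧` (the wall 20395) + `‖coeff m L‖ = 1` to `X^∅_ac(W′/K_∞; slot 𝔭′)`.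
CONDITIONAL on ♭T′ and the wall (displayed); no other input. [cite: GreenbergVatsal2000, Thm. (1.4), §2 Prop. (2.8)]
[cite: Brink2007, Thm. 2 and Cor. 1] -/
theorem twinTorsion_of_defectPT_of_wall (hD : DefectTransportModThreePT) (hwall : AdditiveSplitIMCInclusionAtThree)
    (hPT : PoitouTateSelmerStructureDualityFact) (hPT2 : PoitouTateShaTateDualFact)
    (hO6 : Additive.ClassO6 W 3) (hsurj : W.HasSurjectiveModNGaloisRep 3) (hr : W.analyticRank = 1)
    (hN : W.conductorNorm ℤ = N) (hcong : O6.ModPCongruent W' W 3) (hss : ¬ Addv W' 3) (hN' : W'.conductorNorm ℤ = N')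
    (hK : IsImaginaryQuadratic K) (hHN : SatisfiesHeegnerHypothesis N K) (hHN' : SatisfiesHeegnerHypothesis N' K)
    (hfinE : ∀ (v : HeightOneSpectrum (𝓞 K)), ((3 : ℕ) : 𝓞 K) ∈ v.asIdeal → Finite (selmerAcBase (W.baseChange K) 3 v ∅))
    (κ : ZpExtension K 3) (hκ : κ.IsAnticyclotomic) (γ : absoluteGaloisGroup K) [Fact (κ.IsTopGenerator γ)]
    (𝔭 : HeightOneSpectrum (𝓞 K)) (h𝔭 : ((3 : ℕ) : 𝓞 K) ∈ 𝔭.asIdeal) (he : 𝔭.asIdeal.ramificationIdx (𝓞 ℚ) = 1)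
    (hf : 𝔭.asIdeal.inertiaDeg (𝓞 ℚ) = 1) (𝔭' : HeightOneSpectrum (𝓞 K)) (h𝔭' : ((3 : ℕ) : 𝓞 K) ∈ 𝔭'.asIdeal)
    (hne : 𝔭' ≠ 𝔭) (ι' : PadicAlgCl 3 ≃+* ℂ) (hind : SchneiderFree.BranchInducesPrime 3 ι' 𝔭)
    (htors : Module.IsTorsion (IwasawaAlgebra 3) (XAc (W.baseChange K) 3 κ 𝔭' ∅ γ))
    {ΩK : ℂ} {Ωp : ℂ_[3]} {L : UnrSeries 3} (hΩK : ΩK ≠ 0) (hΩp : Ωp ≠ 0) (hBDP : IsBDPLFunction ι' 𝔭 κ γ Dt.f ΩK Ωp L)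
    {ΩK' : ℂ} {Ωp' : ℂ_[3]} {L' : UnrSeries 3} (hΩK' : ΩK' ≠ 0) (hΩp' : Ωp' ≠ 0)
    (hBDP' : IsBDPLFunction ι' 𝔭 κ γ Dt'.f ΩK' Ωp' L')
    (hi' : ∃ i : ℕ, ‖((PowerSeries.coeff i L' : unrIntegers 3) : ℂ_[3])‖ = 1) :
    Module.IsTorsion (IwasawaAlgebra 3) (XAc (W'.baseChange K) 3 κ 𝔭' ∅ γ) := by
  have hle : Ideal.span {L} ≤ (XAc.charIdeal (W.baseChange K) 3 κ 𝔭' ∅ γ).map (PowerSeries.map (toUnr 3)) :=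
    hwall W N K Dt hO6 hsurj hr hN hK hHN κ hκ γ 𝔭 h𝔭 he hf 𝔭' h𝔭' hne ι' hind ΩK Ωp L hΩK hΩp hBDP
  obtain ⟨g, g', n, m, n', m', -, -, -, hL, -, -, -⟩ :=
    hD hPT hPT2 W W' N N' K Dt Dt' hO6 hsurj hr hN hcong hss hN' hK hHN hHN' hfinE κ hκ γ 𝔭 𝔭' h𝔭 he hf h𝔭' hne ι'
      hind htors ΩK Ωp L hΩK hΩp hBDP hle ΩK' Ωp' L' hΩK' hΩp' hBDP' hi'
  exact (defectTransport_torsionMu_of_wall W W' K hN hcong hN' hK hHN hHN' κ hκ γ h𝔭' htors hle ⟨m, hL.2⟩).2.2.1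

/-! ### §2 The squeeze on ♭T′ → wall → μ, torsion-conditional twin clause -/

/-- **The cross-squeeze on ♭T′ `DefectTransportModThreePT` → wall 20395 → μ 20400, TORSION-CONDITIONAL currency.** At the
`E`-frame `L` (Flat′'s binders: PT facts, wild base finiteness `hfinE`, `X^∅_ac(E)` torsion `htors` displayed) and a handed twin
frame `L′` whose rational Wan clause `∃ k, 3^k·Ch(W′)·R₀⟦T⟧ ⊆ (L′)` is owed ONLY UNDER torsion of `X^∅_ac(W′)`:
`Ch(E)·R₀⟦T⟧ = (L)`. Steps: wall `(L) ⊆ (g)` ⟹ `n ≤ m`; ♭T′ at `(L, L′)`; §1 ⟹ `X^∅_ac(W′)` torsion ⟹ the clause ⟹ `L′ ∣ g′`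
⟹ `m′ ≤ n′`; `n + m′ = n′ + m` ⟹ `n = m` ⟹ `eq_span_of_span_le_of_normProfile` (p531417). p609855 verbatim otherwise.
CONDITIONAL on the three displayed route items. [cite: GreenbergVatsal2000, Thm. (1.4)] [cite: JetchevSkinnerWan2017, §7.4.1] -/
theorem charIdeal_eq_of_defectPT_of_wall_of_mu_torsionConditional (hD : DefectTransportModThreePT)
    (hwall : AdditiveSplitIMCInclusionAtThree) (hmu : TwinMuZeroAtThree)
    (hPT : PoitouTateSelmerStructureDualityFact) (hPT2 : PoitouTateShaTateDualFact)
    (hO6 : Additive.ClassO6 W 3) (hsurj : W.HasSurjectiveModNGaloisRep 3) (hr : W.analyticRank = 1)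
    (hN : W.conductorNorm ℤ = N) (hcong : O6.ModPCongruent W' W 3) (hss : ¬ Addv W' 3) (hN' : W'.conductorNorm ℤ = N')
    (hK : IsImaginaryQuadratic K) (hHN : SatisfiesHeegnerHypothesis N K) (hHN' : SatisfiesHeegnerHypothesis N' K)
    (hfinE : ∀ (v : HeightOneSpectrum (𝓞 K)), ((3 : ℕ) : 𝓞 K) ∈ v.asIdeal → Finite (selmerAcBase (W.baseChange K) 3 v ∅))
    (κ : ZpExtension K 3) (hκ : κ.IsAnticyclotomic) (γ : absoluteGaloisGroup K) [Fact (κ.IsTopGenerator γ)]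
    (𝔭 : HeightOneSpectrum (𝓞 K)) (h𝔭 : ((3 : ℕ) : 𝓞 K) ∈ 𝔭.asIdeal) (he : 𝔭.asIdeal.ramificationIdx (𝓞 ℚ) = 1)
    (hf : 𝔭.asIdeal.inertiaDeg (𝓞 ℚ) = 1) (𝔭' : HeightOneSpectrum (𝓞 K)) (h𝔭' : ((3 : ℕ) : 𝓞 K) ∈ 𝔭'.asIdeal)
    (hne : 𝔭' ≠ 𝔭) (ι' : PadicAlgCl 3 ≃+* ℂ) (hind : SchneiderFree.BranchInducesPrime 3 ι' 𝔭)
    (htors : Module.IsTorsion (IwasawaAlgebra 3) (XAc (W.baseChange K) 3 κ 𝔭' ∅ γ))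
    (hwan : ∃ (ΩK' : ℂ) (Ωp' : ℂ_[3]) (L' : UnrSeries 3), ΩK' ≠ 0 ∧ Ωp' ≠ 0 ∧ IsBDPLFunction ι' 𝔭 κ γ Dt'.f ΩK' Ωp' L' ∧
      (Module.IsTorsion (IwasawaAlgebra 3) (XAc (W'.baseChange K) 3 κ 𝔭' ∅ γ) →
        ∃ k : ℕ, ∀ G ∈ (XAc.charIdeal (W'.baseChange K) 3 κ 𝔭' ∅ γ).map (PowerSeries.map (toUnr 3)),
          PowerSeries.C (((3 : ℕ) : unrIntegers 3) ^ k) * G ∈ Ideal.span {L'}))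
    {ΩK : ℂ} {Ωp : ℂ_[3]} {L : UnrSeries 3} (hΩK : ΩK ≠ 0) (hΩp : Ωp ≠ 0)
    (hBDP : IsBDPLFunction ι' 𝔭 κ γ Dt.f ΩK Ωp L) :
    (XAc.charIdeal (W.baseChange K) 3 κ 𝔭' ∅ γ).map (PowerSeries.map (toUnr 3)) = Ideal.span {L} := by
  -- adapted from p609855 `toricTransportModThreeFlat_of_wall_of_defect_of_mu` (utd-p1 g11); the one new step is marked
  have hle : Ideal.span {L} ≤ (XAc.charIdeal (W.baseChange K) 3 κ 𝔭' ∅ γ).map (PowerSeries.map (toUnr 3)) :=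
    hwall W N K Dt hO6 hsurj hr hN hK hHN κ hκ γ 𝔭 h𝔭 he hf 𝔭' h𝔭' hne ι' hind ΩK Ωp L hΩK hΩp hBDP
  obtain ⟨ΩK', Ωp', L', hΩK', hΩp', hBDP', hkT⟩ := hwan
  have hi' : ∃ i : ℕ, ‖((PowerSeries.coeff i L' : unrIntegers 3) : ℂ_[3])‖ = 1 :=
    hmu W W' N N' K Dt Dt' hO6 hsurj hr hN hcong hss hN' hK hHN hHN' κ hκ γ 𝔭 h𝔭 he hf 𝔭' h𝔭' hne ι' hind ΩK' Ωp' L'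
      hΩK' hΩp' hBDP'
  obtain ⟨g, g', n, m, n', m', hIE, hI', hg, hL, hg', hL', hsum⟩ :=
    hD hPT hPT2 W W' N N' K Dt Dt' hO6 hsurj hr hN hcong hss hN' hK hHN hHN' hfinE κ hκ γ 𝔭 𝔭' h𝔭 he hf h𝔭' hne ι'
      hind htors ΩK Ωp L hΩK hΩp hBDP hle ΩK' Ωp' L' hΩK' hΩp' hBDP' hi'
  -- NEW: torsion of `X^∅_ac(W′)` from `X^∅_ac(E)` torsion + wall + the unit coefficient `m` of `L` (p611201), THEN the clause
  have htors' : Module.IsTorsion (IwasawaAlgebra 3) (XAc (W'.baseChange K) 3 κ 𝔭' ∅ γ) :=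
    (defectTransport_torsionMu_of_wall W W' K hN hcong hN' hK hHN hHN' κ hκ γ h𝔭' htors hle ⟨m, hL.2⟩).2.2.1
  have hk := hkT htors'
  have hgL : g ∣ L := by
    rw [hIE] at hle
    exact Ideal.mem_span_singleton.mp (hle (Ideal.mem_span_singleton_self L))
  have h₁ : n ≤ m := firstUnitCoeff_le_of_dvd hgL hg.1 hL.2
  have hL'g' : L' ∣ g' :=
    dvd_of_mem_of_C_pow_mul_mem_span hL'.1 hL'.2 hk (hI' ▸ Ideal.mem_span_singleton_self g')
  have h₂ : m' ≤ n' := firstUnitCoeff_le_of_dvd hL'g' hL'.1 hg'.2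
  have hnm : n = m := by omega
  subst hnm
  exact eq_span_of_span_le_of_normProfile hIE hle hg.1 hL.2

/-- **The cross-squeeze on ♭T′ → wall → μ, act E's currency** (the twin hands a frame WITH its rational Wan clause, as in
kernel″ 26977 / Flat′ of SketchE.lean): `Ch(E)·R₀⟦T⟧ = (L)` — the special case of the torsion-conditional squeeze where the
clause ignores its hypothesis. [cite: GreenbergVatsal2000, Thm. (1.4)] [cite: JetchevSkinnerWan2017, §7.4.1] -/
theorem charIdeal_eq_of_defectPT_of_wall_of_mu (hD : DefectTransportModThreePT)
    (hwall : AdditiveSplitIMCInclusionAtThree) (hmu : TwinMuZeroAtThree)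
    (hPT : PoitouTateSelmerStructureDualityFact) (hPT2 : PoitouTateShaTateDualFact)
    (hO6 : Additive.ClassO6 W 3) (hsurj : W.HasSurjectiveModNGaloisRep 3) (hr : W.analyticRank = 1)
    (hN : W.conductorNorm ℤ = N) (hcong : O6.ModPCongruent W' W 3) (hss : ¬ Addv W' 3) (hN' : W'.conductorNorm ℤ = N')
    (hK : IsImaginaryQuadratic K) (hHN : SatisfiesHeegnerHypothesis N K) (hHN' : SatisfiesHeegnerHypothesis N' K)
    (hfinE : ∀ (v : HeightOneSpectrum (𝓞 K)), ((3 : ℕ) : 𝓞 K) ∈ v.asIdeal → Finite (selmerAcBase (W.baseChange K) 3 v ∅))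
    (κ : ZpExtension K 3) (hκ : κ.IsAnticyclotomic) (γ : absoluteGaloisGroup K) [Fact (κ.IsTopGenerator γ)]
    (𝔭 : HeightOneSpectrum (𝓞 K)) (h𝔭 : ((3 : ℕ) : 𝓞 K) ∈ 𝔭.asIdeal) (he : 𝔭.asIdeal.ramificationIdx (𝓞 ℚ) = 1)
    (hf : 𝔭.asIdeal.inertiaDeg (𝓞 ℚ) = 1) (𝔭' : HeightOneSpectrum (𝓞 K)) (h𝔭' : ((3 : ℕ) : 𝓞 K) ∈ 𝔭'.asIdeal)
    (hne : 𝔭' ≠ 𝔭) (ι' : PadicAlgCl 3 ≃+* ℂ) (hind : SchneiderFree.BranchInducesPrime 3 ι' 𝔭)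
    (htors : Module.IsTorsion (IwasawaAlgebra 3) (XAc (W.baseChange K) 3 κ 𝔭' ∅ γ))
    (hwan : ∃ (ΩK' : ℂ) (Ωp' : ℂ_[3]) (L' : UnrSeries 3), ΩK' ≠ 0 ∧ Ωp' ≠ 0 ∧ IsBDPLFunction ι' 𝔭 κ γ Dt'.f ΩK' Ωp' L' ∧
      ∃ k : ℕ, ∀ G ∈ (XAc.charIdeal (W'.baseChange K) 3 κ 𝔭' ∅ γ).map (PowerSeries.map (toUnr 3)),
        PowerSeries.C (((3 : ℕ) : unrIntegers 3) ^ k) * G ∈ Ideal.span {L'})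
    {ΩK : ℂ} {Ωp : ℂ_[3]} {L : UnrSeries 3} (hΩK : ΩK ≠ 0) (hΩp : Ωp ≠ 0)
    (hBDP : IsBDPLFunction ι' 𝔭 κ γ Dt.f ΩK Ωp L) :
    (XAc.charIdeal (W.baseChange K) 3 κ 𝔭' ∅ γ).map (PowerSeries.map (toUnr 3)) = Ideal.span {L} := by
  obtain ⟨ΩK', Ωp', L', hΩK', hΩp', hBDP', hk⟩ := hwan
  exact charIdeal_eq_of_defectPT_of_wall_of_mu_torsionConditional W W' N N' K Dt Dt' hD hwall hmu hPT hPT2 hO6 hsurj hr hN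
    hcong hss hN' hK hHN hHN' hfinE κ hκ γ 𝔭 h𝔭 he hf 𝔭' h𝔭' hne ι' hind htors ⟨ΩK', Ωp', L', hΩK', hΩp', hBDP', fun _ ↦ hk⟩
    hΩK hΩp hBDP

/-- **Bonus: the twin's OWN equality at the handed frame, torsion-conditional currency** — under ♭T′ + wall + μ and ONE
`E`-frame `L`, a twin frame `L′` owing `3^k·Ch(W′)·R₀⟦T⟧ ⊆ (L′)` only under torsion of `X^∅_ac(W′)` has `Ch(W′)·R₀⟦T⟧ = (L′)`
(`n′ = m′` from the same squeeze; p609855's `twinIMC_of_wall_of_defect_of_mu` re-threaded). CONDITIONAL; closes nothing.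
[cite: GreenbergVatsal2000, Thm. (1.4)] -/
theorem twinIMC_of_defectPT_of_wall_of_mu_torsionConditional (hD : DefectTransportModThreePT)
    (hwall : AdditiveSplitIMCInclusionAtThree) (hmu : TwinMuZeroAtThree)
    (hPT : PoitouTateSelmerStructureDualityFact) (hPT2 : PoitouTateShaTateDualFact)
    (hO6 : Additive.ClassO6 W 3) (hsurj : W.HasSurjectiveModNGaloisRep 3) (hr : W.analyticRank = 1)
    (hN : W.conductorNorm ℤ = N) (hcong : O6.ModPCongruent W' W 3) (hss : ¬ Addv W' 3) (hN' : W'.conductorNorm ℤ = N')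
    (hK : IsImaginaryQuadratic K) (hHN : SatisfiesHeegnerHypothesis N K) (hHN' : SatisfiesHeegnerHypothesis N' K)
    (hfinE : ∀ (v : HeightOneSpectrum (𝓞 K)), ((3 : ℕ) : 𝓞 K) ∈ v.asIdeal → Finite (selmerAcBase (W.baseChange K) 3 v ∅))
    (κ : ZpExtension K 3) (hκ : κ.IsAnticyclotomic) (γ : absoluteGaloisGroup K) [Fact (κ.IsTopGenerator γ)]
    (𝔭 : HeightOneSpectrum (𝓞 K)) (h𝔭 : ((3 : ℕ) : 𝓞 K) ∈ 𝔭.asIdeal) (he : 𝔭.asIdeal.ramificationIdx (𝓞 ℚ) = 1)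
    (hf : 𝔭.asIdeal.inertiaDeg (𝓞 ℚ) = 1) (𝔭' : HeightOneSpectrum (𝓞 K)) (h𝔭' : ((3 : ℕ) : 𝓞 K) ∈ 𝔭'.asIdeal)
    (hne : 𝔭' ≠ 𝔭) (ι' : PadicAlgCl 3 ≃+* ℂ) (hind : SchneiderFree.BranchInducesPrime 3 ι' 𝔭)
    (htors : Module.IsTorsion (IwasawaAlgebra 3) (XAc (W.baseChange K) 3 κ 𝔭' ∅ γ))
    {ΩK : ℂ} {Ωp : ℂ_[3]} {L : UnrSeries 3} (hΩK : ΩK ≠ 0) (hΩp : Ωp ≠ 0)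
    (hBDP : IsBDPLFunction ι' 𝔭 κ γ Dt.f ΩK Ωp L)
    {ΩK' : ℂ} {Ωp' : ℂ_[3]} {L' : UnrSeries 3} (hΩK' : ΩK' ≠ 0) (hΩp' : Ωp' ≠ 0)
    (hBDP' : IsBDPLFunction ι' 𝔭 κ γ Dt'.f ΩK' Ωp' L')
    (hkT : Module.IsTorsion (IwasawaAlgebra 3) (XAc (W'.baseChange K) 3 κ 𝔭' ∅ γ) →
      ∃ k : ℕ, ∀ G ∈ (XAc.charIdeal (W'.baseChange K) 3 κ 𝔭' ∅ γ).map (PowerSeries.map (toUnr 3)),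
        PowerSeries.C (((3 : ℕ) : unrIntegers 3) ^ k) * G ∈ Ideal.span {L'}) :
    (XAc.charIdeal (W'.baseChange K) 3 κ 𝔭' ∅ γ).map (PowerSeries.map (toUnr 3)) = Ideal.span {L'} := by
  have hle : Ideal.span {L} ≤ (XAc.charIdeal (W.baseChange K) 3 κ 𝔭' ∅ γ).map (PowerSeries.map (toUnr 3)) :=
    hwall W N K Dt hO6 hsurj hr hN hK hHN κ hκ γ 𝔭 h𝔭 he hf 𝔭' h𝔭' hne ι' hind ΩK Ωp L hΩK hΩp hBDP
  have hi' : ∃ i : ℕ, ‖((PowerSeries.coeff i L' : unrIntegers 3) : ℂ_[3])‖ = 1 :=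
    hmu W W' N N' K Dt Dt' hO6 hsurj hr hN hcong hss hN' hK hHN hHN' κ hκ γ 𝔭 h𝔭 he hf 𝔭' h𝔭' hne ι' hind ΩK' Ωp' L'
      hΩK' hΩp' hBDP'
  obtain ⟨g, g', n, m, n', m', hIE, hI', hg, hL, hg', hL', hsum⟩ :=
    hD hPT hPT2 W W' N N' K Dt Dt' hO6 hsurj hr hN hcong hss hN' hK hHN hHN' hfinE κ hκ γ 𝔭 𝔭' h𝔭 he hf h𝔭' hne ι'
      hind htors ΩK Ωp L hΩK hΩp hBDP hle ΩK' Ωp' L' hΩK' hΩp' hBDP' hi'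
  have htors' : Module.IsTorsion (IwasawaAlgebra 3) (XAc (W'.baseChange K) 3 κ 𝔭' ∅ γ) :=
    (defectTransport_torsionMu_of_wall W W' K hN hcong hN' hK hHN hHN' κ hκ γ h𝔭' htors hle ⟨m, hL.2⟩).2.2.1
  have hk := hkT htors'
  have hgL : g ∣ L := by
    rw [hIE] at hle
    exact Ideal.mem_span_singleton.mp (hle (Ideal.mem_span_singleton_self L))
  have h₁ : n ≤ m := firstUnitCoeff_le_of_dvd hgL hg.1 hL.2
  have hL'g' : L' ∣ g' :=
    dvd_of_mem_of_C_pow_mul_mem_span hL'.1 hL'.2 hk (hI' ▸ Ideal.mem_span_singleton_self g')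
  have h₂ : m' ≤ n' := firstUnitCoeff_le_of_dvd hL'g' hL'.1 hg'.2
  have hnm' : n' = m' := by omega
  subst hnm'
  rw [hI']
  exact (span_eq_span_of_dvd_of_normProfile hL'g' hL'.1 hg'.2).symm

end Squeeze

end Summit.BirchSwinnertonDyer.BirchSwinnertonDyer.Theorems.UniversalToricDescentDefectPTSqueeze

end
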